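import Mathlib
import HarnessLib
import Literature.Probability.Percolation.MinOpenCut
import Literature.Probability.Percolation.MinOpenCutMenger
import Summits.CriticalPhenomena.PercolationContinuityZ3.Theorems.PercBudgetLadderZhangBaseTools
import Summits.CriticalPhenomena.PercolationContinuityZ3.Theorems.PercBudgetLadderBudgetTightnessStubPatchCutset
import Summits.CriticalPhenomena.PercolationContinuityZ3.Theorems.PercBudgetLadderBudgetTightnessStubThickMono
import Summits.CriticalPhenomena.PercolationContinuityZ3.Theorems.PercBudgetLadderBudgetTightnessStubSixLids

/-!
# `stub_slabCeiling` of line `Sketch` (crux `BudgetTightness`, stmt-CriticalPhenomena-5248):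
# Zhang's zero critical flow constant in slab coordinates, `E_{p_c}[S(L, h)] = o(L²)` as `h → ∞`

Registered stub `stub_slabCeiling` of the lead's skeleton
`Cruxes/BudgetTightness/Lines/Sketch.lean`.

Notation of the docstrings. `Q(L, h) = [0, L]² × [0, h] = Set.Icc ![0,0,0] ![L,L,h] ⊆ ℤ³` is a slab
piece with bottom layer `{x₂ = 0}` and top layer `{x₂ = h}`;
`S(L, h)(ω) = minOpenCutIn Q(L,h) bottom top ω` is its bottom-to-top min-cut budget
(`Literature/Probability/Percolation/MinOpenCut.lean`); `B(n) = box 3 n`,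
`∂ⁱⁿB(n) = innerBoundary (zdGraph 3) (box 3 n)`, `MinCut(n, 2n) = minOpenCutIn B(2n) B(n) ∂ⁱⁿB(2n)`
(the annulus budget); `E_p[·] = ∫ (·).toNat ∂ bondPercolation (zdGraph 3) p`;
`armH r = {0 ↔ distance r inside the half-space}` (`QuantitativeBGN/Negative/ArmLowerBound.lean`).

THE STATEMENT (the CEILING known today, against the core's `E_{p_c}[S(L,h)] ≤ C L²/h²` i.o.):
for every `ε > 0` there is `H` with `E_{p_c}[S(L, h)] ≤ ε · L²` for all `h ≥ H` and all `L ≥ h`.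

PROOF.
* (i) `StubSlabCeiling.integral_annulus_le` — EXPECTED ANNULUS BUDGET: for `r + 1 ≤ n` and every
  `p`, `E_p[MinCut(n, 2n)] ≤ 576 n² · P_p(armH r)`. A.s. `ω ⊆ E(ℤ³)`
  (`ProbabilityTheory.setBernoulli_ae_subset`); for such `ω` the Rossignol–Théret cutset
  (`PercBudgetLadderZhangBase.exists_cutset`, Rossignol–Théret 2018 Prop. 3.9 in tree) is a finite
  open cutset of the annulus of size `≤ 6 N(ω)`,
  `N = ∑_{u ∈ ∂ⁱⁿB(n+r)} 𝟙{u joined to B(n) in B(n+r)}`, so `MinCut(n,2n)(ω) ≤ 6 N(ω)`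
  (`minOpenCutIn_le_card`); integrate (`integral_mono_ae`,
  `integral_finsetSum`, `integral_indicator_one`) and bound each `P_p(J u) ≤ P_p(armH r)`
  (`real_setOf_joined_le_armH`, lattice symmetry) and `#∂ⁱⁿB(n+r) ≤ 96 n²`
  (`card_innerBoundary_box_le`).
* (ii) `StubSlabCeiling.integral_slab_four_le` — PATCHES: by the landed `stub_patchCutset` (aspect
  `l = 2`, `m = n`), `E_p[S(L, 4n)] ≤ A² · E_p[MinCut(n, 2n)]`, `A = (L + 2n + 1)/(2n + 1)`; with
  (i) at `r = n - 1` and `A · n ≤ L` (for `4n ≤ L`, `1 ≤ n`) this is `≤ 576 L² · P_p(armH (n-1))`.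
* (iii) `StubSlabCeiling.integral_slab_antitone` — THICKNESS: `h ↦ S(L, h)(ω)` is antitone on
  lattice configurations (iterate the landed `stub_thickMono`), the budgets are finite for `h ≥ 1`
  (bottom ∩ top = ∅, `minOpenCutIn_eq_top_iff_of_finite`), hence `E_p[S(L, b)] ≤ E_p[S(L, a)]` for
  `1 ≤ a ≤ b` (`integral_mono_ae`, integrability `StubPatchCutset.integrable_toNat_minOpenCutIn`).
* (iv) ASSEMBLY at `p_c`: `P_{p_c}(armH r) → 0` (Barsky–Grimmett–Newman,
  `QuantitativeBGN.Negative.tendsto_armH_criticalProb`, resting on the in-tree proved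
  `BarskyGrimmettNewman1991_Z3_holds`); choose `R` with `P_{p_c}(armH r) < ε/576` for `r ≥ R`, put
  `H := 4 (R + 1)`, `n := h / 4`:
  `E_{p_c}[S(L,h)] ≤ E_{p_c}[S(L,4n)] ≤ 576 L² P_{p_c}(armH(n-1)) ≤ ε L²`.
-/

noncomputable section

namespace Summit.CriticalPhenomena.PercolationContinuityZ3.Theorems.BudgetTightness

open MeasureTheory Filter Topology
open Literature.Probability.Percolation Literature.Probability.LatticeModels

namespace StubSlabCeiling

open Summit.CriticalPhenomena.PercolationContinuityZ3.Theorems.QuantitativeBGN.Negative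
  (armH tendsto_armH_criticalProb)
open Summit.CriticalPhenomena.PercolationContinuityZ3.Theorems.PercBudgetLadderZhangBase
  (exists_cutset real_setOf_joined_le_armH measurableSet_setOf_joined)

/-! ### (i) Expected annulus budget from the Rossignol–Théret cutset -/

/-- **Expected annulus budget.** For every `p` and `r + 1 ≤ n`,
`E_p[MinCut(n, 2n)] ≤ 576 · n² · P_p(armH r)`: a.s. `ω ⊆ E(ℤ³)`, and then the Rossignol–Théret
cutset `T(ω)` (`PercBudgetLadderZhangBase.exists_cutset`) is a finite open cutset of the annulus
`B(n) → ∂ⁱⁿB(2n)` inside `B(2n)` with `#T(ω) ≤ 6 · N(ω)`, `N = ∑_{u ∈ ∂ⁱⁿB(n+r)} 𝟙_{J(n,r,u)}`;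
integrating, `E_p[N] = ∑_u P_p(J(n,r,u)) ≤ #∂ⁱⁿB(n+r) · P_p(armH r) ≤ 96 n² · P_p(armH r)`
(`real_setOf_joined_le_armH`, `card_innerBoundary_box_le`). -/
theorem integral_annulus_le (p : unitInterval) {n r : ℕ} (hrn : r + 1 ≤ n) :
    ∫ ω, ((minOpenCutIn (↑(box 3 (2 * n)) : Set (Site 3)) (↑(box 3 n) : Set (Site 3))
        (↑(innerBoundary (zdGraph 3) (box 3 (2 * n))) : Set (Site 3)) ω).toNat : ℝ)
        ∂(bondPercolation (zdGraph 3) p) ≤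
      576 * (n : ℝ) ^ 2 * (bondPercolation (zdGraph 3) p).real (armH r) := by
  set μ := bondPercolation (zdGraph 3) p with hμ
  set Fm := innerBoundary (zdGraph 3) (box 3 (n + r)) with hFm
  set J : Site 3 → Set (BondConfig (Site 3)) := fun u => {ω' : BondConfig (Site 3) | ∃ x ∈ box 3 n,
      ω' ∈ openConnIn (↑(box 3 (n + r)) : Set (Site 3)) u x} with hJ
  have hJm : ∀ u, MeasurableSet (J u) := fun u => measurableSet_setOf_joined n r u
  -- a.s. pointwise bound `MinCut ≤ #T ≤ 6 N`
  have hpt : ∀ᵐ ω ∂μ, ((minOpenCutIn (↑(box 3 (2 * n)) : Set (Site 3)) (↑(box 3 n) : Set (Site 3))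
      (↑(innerBoundary (zdGraph 3) (box 3 (2 * n))) : Set (Site 3)) ω).toNat : ℝ) ≤
      6 * ∑ u ∈ Fm, (J u).indicator (1 : BondConfig (Site 3) → ℝ) ω := by
    filter_upwards [(ProbabilityTheory.setBernoulli_ae_subset : ∀ᵐ ω ∂μ, ω ⊆ (zdGraph 3).edgeSet)]
      with ω hω
    obtain ⟨T, hT, hcut⟩ := exists_cutset hrn hω
    have h1 : (minOpenCutIn (↑(box 3 (2 * n)) : Set (Site 3)) (↑(box 3 n) : Set (Site 3))
        (↑(innerBoundary (zdGraph 3) (box 3 (2 * n))) : Set (Site 3)) ω).toNat ≤ T.card :=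
      ENat.toNat_le_of_le_coe (minOpenCutIn_le_card (isOpenCutsetIn_iff_not_exists.2 hcut))
    exact le_trans (by exact_mod_cast h1) hT
  have hJi : ∀ u, Integrable (fun ω => (J u).indicator (1 : BondConfig (Site 3) → ℝ) ω) μ :=
    fun u => (integrable_const (1 : ℝ)).indicator (hJm u)
  have hint :
      Integrable (fun ω => 6 * ∑ u ∈ Fm, (J u).indicator (1 : BondConfig (Site 3) → ℝ) ω) μ :=
    (integrable_finsetSum Fm fun u _ => hJi u).const_mul 6
  have hcard : (Fm.card : ℝ) ≤ 96 * (n : ℝ) ^ 2 := by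
    have h1 : Fm.card ≤ 2 * 3 * (2 * (n + r) + 1) ^ (3 - 1) := card_innerBoundary_box_le (n + r)
    have h2 : 2 * (n + r) + 1 ≤ 4 * n := by omega
    have h3 : Fm.card ≤ 96 * n ^ 2 := by
      calc Fm.card ≤ 6 * (2 * (n + r) + 1) ^ 2 := by simpa using h1
        _ ≤ 6 * (4 * n) ^ 2 := by gcongr
        _ = 96 * n ^ 2 := by ring
    exact_mod_cast h3
  calc ∫ ω, ((minOpenCutIn (↑(box 3 (2 * n)) : Set (Site 3)) (↑(box 3 n) : Set (Site 3))
        (↑(innerBoundary (zdGraph 3) (box 3 (2 * n))) : Set (Site 3)) ω).toNat : ℝ) ∂μ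
      ≤ ∫ ω, 6 * ∑ u ∈ Fm, (J u).indicator (1 : BondConfig (Site 3) → ℝ) ω ∂μ :=
        integral_mono_ae
          (StubPatchCutset.integrable_toNat_minOpenCutIn (Finset.finite_toSet _) _ _ _) hint hpt
    _ = 6 * ∑ u ∈ Fm, μ.real (J u) := by
        rw [integral_const_mul, integral_finsetSum Fm fun u _ => hJi u]
        congr 1
        exact Finset.sum_congr rfl fun u _ => integral_indicator_one (hJm u)
    _ ≤ 6 * ∑ u ∈ Fm, μ.real (armH r) :=
        mul_le_mul_of_nonneg_left (Finset.sum_le_sum fun u hu => real_setOf_joined_le_armH p hu)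
          (by norm_num)
    _ = 6 * ((Fm.card : ℝ) * μ.real (armH r)) := by rw [Finset.sum_const, nsmul_eq_mul]
    _ ≤ 6 * (96 * (n : ℝ) ^ 2 * μ.real (armH r)) := by gcongr
    _ = 576 * (n : ℝ) ^ 2 * μ.real (armH r) := by ring

/-! ### (ii) Patches: the piece of thickness `4n` -/

/-- **The piece of thickness `4n`.** For `1 ≤ n` and `4n ≤ L`,
`E_p[S(L, 4n)] ≤ 576 · L² · P_p(armH (n - 1))`: by the landed `stub_patchCutset` (aspect `l = 2`,
`m = n`), `E_p[S(L, 4n)] ≤ A² · E_p[MinCut(n, 2n)]` with `A = (L + 2n + 1)/(2n + 1)` (so that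
`A · n ≤ L`, using `2n + 1 ≤ L`), and `E_p[MinCut(n, 2n)] ≤ 576 n² P_p(armH (n-1))`
(`integral_annulus_le` with `r = n - 1`). -/
theorem integral_slab_four_le (p : unitInterval) {n L : ℕ} (hn : 1 ≤ n) (hL : 4 * n ≤ L) :
    ∫ ω, ((minOpenCutIn
        (Set.Icc (![0, 0, 0] : Site 3) ![(L : ℤ), (L : ℤ), ((2 * 2 * n : ℕ) : ℤ)])
        (Set.Icc (![0, 0, 0] : Site 3) ![(L : ℤ), (L : ℤ), 0])
        (Set.Icc (![0, 0, ((2 * 2 * n : ℕ) : ℤ)] : Site 3)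
          ![(L : ℤ), (L : ℤ), ((2 * 2 * n : ℕ) : ℤ)])
        ω).toNat : ℝ) ∂(bondPercolation (zdGraph 3) p) ≤
      576 * (L : ℝ) ^ 2 * (bondPercolation (zdGraph 3) p).real (armH (n - 1)) := by
  have h1 := stub_patchCutset p n 2 L hn le_rfl
  have hrn : (n - 1) + 1 ≤ n := by omega
  have h2 := integral_annulus_le p hrn
  have hA1 : (L + 2 * n + 1) / (2 * n + 1) * (2 * n + 1) ≤ L + 2 * n + 1 := Nat.div_mul_le_self _ _
  have hAn : (((L + 2 * n + 1) / (2 * n + 1) : ℕ) : ℝ) * n ≤ L := by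
    have h3 : (((L + 2 * n + 1) / (2 * n + 1) : ℕ) : ℝ) * (2 * n + 1) ≤ L + 2 * n + 1 := by
      exact_mod_cast hA1
    have h4 : (4 : ℝ) * n ≤ L := by exact_mod_cast hL
    have h5 : (1 : ℝ) ≤ n := by exact_mod_cast hn
    have hA0 : (0 : ℝ) ≤ (((L + 2 * n + 1) / (2 * n + 1) : ℕ) : ℝ) := Nat.cast_nonneg _
    nlinarith
  have hAn0 : (0 : ℝ) ≤ (((L + 2 * n + 1) / (2 * n + 1) : ℕ) : ℝ) * n := by positivity
  have hP : 0 ≤ (bondPercolation (zdGraph 3) p).real (armH (n - 1)) := measureReal_nonneg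
  calc _ ≤ _ := h1
    _ ≤ (((L + 2 * n + 1) / (2 * n + 1) : ℕ) : ℝ) ^ 2 *
          (576 * (n : ℝ) ^ 2 * (bondPercolation (zdGraph 3) p).real (armH (n - 1))) := by
        gcongr
    _ = 576 * ((((L + 2 * n + 1) / (2 * n + 1) : ℕ) : ℝ) * n) ^ 2 *
          (bondPercolation (zdGraph 3) p).real (armH (n - 1)) := by ring
    _ ≤ 576 * (L : ℝ) ^ 2 * (bondPercolation (zdGraph 3) p).real (armH (n - 1)) := by
        gcongr

/-! ### (iii) Thickness: `h ↦ S(L, h)` is antitone, pointwise and in expectation -/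

/-- **Iterated thickness monotonicity** (from the landed `stub_thickMono`): for `a ≤ b` and a
lattice configuration `ω ⊆ E(ℤ³)`, `S(L, b)(ω) ≤ S(L, a)(ω)`. -/
theorem minOpenCutIn_slab_antitone (L : ℕ) {a b : ℕ} (hab : a ≤ b) {ω : BondConfig (Site 3)}
    (hω : ω ⊆ (zdGraph 3).edgeSet) :
    minOpenCutIn
        (Set.Icc (![0, 0, 0] : Site 3) ![(L : ℤ), (L : ℤ), (b : ℤ)])
        (Set.Icc (![0, 0, 0] : Site 3) ![(L : ℤ), (L : ℤ), 0])
        (Set.Icc (![0, 0, (b : ℤ)] : Site 3) ![(L : ℤ), (L : ℤ), (b : ℤ)]) ω ≤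
      minOpenCutIn
        (Set.Icc (![0, 0, 0] : Site 3) ![(L : ℤ), (L : ℤ), (a : ℤ)])
        (Set.Icc (![0, 0, 0] : Site 3) ![(L : ℤ), (L : ℤ), 0])
        (Set.Icc (![0, 0, (a : ℤ)] : Site 3) ![(L : ℤ), (L : ℤ), (a : ℤ)]) ω := by
  induction b, hab using Nat.le_induction with
  | base => exact le_rfl
  | succ b _ ih => exact (stub_thickMono L b ω hω).trans ih

/-- **The slab budget is finite for positive thickness**: for `1 ≤ h` the bottom and top layers of
`Q(L, h)` are disjoint, so `S(L, h)(ω) ≠ ⊤` (`minOpenCutIn_eq_top_iff_of_finite`). -/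
theorem minOpenCutIn_slab_ne_top (L : ℕ) {h : ℕ} (hh : 1 ≤ h) (ω : BondConfig (Site 3)) :
    minOpenCutIn
        (Set.Icc (![0, 0, 0] : Site 3) ![(L : ℤ), (L : ℤ), (h : ℤ)])
        (Set.Icc (![0, 0, 0] : Site 3) ![(L : ℤ), (L : ℤ), 0])
        (Set.Icc (![0, 0, (h : ℤ)] : Site 3) ![(L : ℤ), (L : ℤ), (h : ℤ)]) ω ≠ ⊤ := by
  rw [Ne, minOpenCutIn_eq_top_iff_of_finite (Set.finite_Icc _ _)]
  rintro ⟨a, -, haB, haT⟩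
  rw [StubPatchCutset.mem_Icc_vec3] at haB haT
  have h1 := haB.2.2.2
  have h2 := haT.2.2.1
  have h3 : (1 : ℤ) ≤ (h : ℤ) := by exact_mod_cast hh
  omega

/-- **Thickness monotonicity in expectation**: for `1 ≤ a ≤ b`, `E_p[S(L, b)] ≤ E_p[S(L, a)]`
(a.s. `ω ⊆ E(ℤ³)`, `ProbabilityTheory.setBernoulli_ae_subset`; both budgets are finite and
integrable, `StubPatchCutset.integrable_toNat_minOpenCutIn`). -/
theorem integral_slab_antitone (p : unitInterval) (L : ℕ) {a b : ℕ} (ha : 1 ≤ a) (hab : a ≤ b) :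
    ∫ ω, ((minOpenCutIn
        (Set.Icc (![0, 0, 0] : Site 3) ![(L : ℤ), (L : ℤ), (b : ℤ)])
        (Set.Icc (![0, 0, 0] : Site 3) ![(L : ℤ), (L : ℤ), 0])
        (Set.Icc (![0, 0, (b : ℤ)] : Site 3) ![(L : ℤ), (L : ℤ), (b : ℤ)])
        ω).toNat : ℝ) ∂(bondPercolation (zdGraph 3) p) ≤
      ∫ ω, ((minOpenCutIn
        (Set.Icc (![0, 0, 0] : Site 3) ![(L : ℤ), (L : ℤ), (a : ℤ)])
        (Set.Icc (![0, 0, 0] : Site 3) ![(L : ℤ), (L : ℤ), 0])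
        (Set.Icc (![0, 0, (a : ℤ)] : Site 3) ![(L : ℤ), (L : ℤ), (a : ℤ)])
        ω).toNat : ℝ) ∂(bondPercolation (zdGraph 3) p) := by
  refine integral_mono_ae (StubPatchCutset.integrable_toNat_minOpenCutIn (Set.finite_Icc _ _) _ _ _)
    (StubPatchCutset.integrable_toNat_minOpenCutIn (Set.finite_Icc _ _) _ _ _) ?_
  filter_upwards [(ProbabilityTheory.setBernoulli_ae_subset :
    ∀ᵐ ω ∂(bondPercolation (zdGraph 3) p), ω ⊆ (zdGraph 3).edgeSet)] with ω hω
  exact_mod_cast ENat.toNat_le_toNat (minOpenCutIn_slab_antitone L hab hω)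
    (minOpenCutIn_slab_ne_top L ha ω)

end StubSlabCeiling

open StubSlabCeiling in
open Summit.CriticalPhenomena.PercolationContinuityZ3.Theorems.QuantitativeBGN.Negative
  (armH tendsto_armH_criticalProb) in
/-- **`stub_slabCeiling` (registered stub of line `Sketch`, crux stmt-CriticalPhenomena-5248):
Zhang's zero critical flow constant in slab coordinates, `τ_h(p_c) → 0` uniformly in `L ≥ h`.**
For every
`ε > 0` there is `H` with `E_{p_c}[S(L, h)] ≤ ε · L²` for all `h ≥ H`, `L ≥ h`. Proof: with
`n := h / 4` (so `4n ≤ h ≤ L`), `E_{p_c}[S(L, h)] ≤ E_{p_c}[S(L, 4n)]` (thickness monotonicity,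
`integral_slab_antitone`) `≤ 576 · L² · P_{p_c}(armH (n - 1))` (patch cutsets + the Rossignol–Théret
expected annulus budget, `integral_slab_four_le`) `≤ ε · L²` once `n - 1 ≥ R`, where
`P_{p_c}(armH r) < ε / 576` for `r ≥ R` by Barsky–Grimmett–Newman at `p_c`
(`QuantitativeBGN.Negative.tendsto_armH_criticalProb`); take `H := 4 (R + 1)`. -/
theorem stub_slabCeiling :
    ∀ ε : ℝ, 0 < ε → ∃ H : ℕ, ∀ h : ℕ, H ≤ h → ∀ L : ℕ, h ≤ L →
      ∫ ω, ((minOpenCutIn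
          (Set.Icc (![0, 0, 0] : Site 3) ![(L : ℤ), (L : ℤ), (h : ℤ)])
          (Set.Icc (![0, 0, 0] : Site 3) ![(L : ℤ), (L : ℤ), 0])
          (Set.Icc (![0, 0, (h : ℤ)] : Site 3) ![(L : ℤ), (L : ℤ), (h : ℤ)])
          ω).toNat : ℝ) ∂(bondPercolation (zdGraph 3) (criticalProbI 3)) ≤ ε * (L : ℝ) ^ 2 := by
  intro ε hε
  have hev : ∀ᶠ r in atTop,
      (bondPercolation (zdGraph 3) (criticalProbI 3)).real (armH r) < ε / 576 :=
    (tendsto_order.1 tendsto_armH_criticalProb).2 _ (by positivity)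
  obtain ⟨R, hR⟩ := eventually_atTop.1 hev
  refine ⟨4 * (R + 1), fun h hh L hL => ?_⟩
  -- `n := h / 4`: `R + 1 ≤ n`, `4 n ≤ h ≤ L`
  have hn1 : R + 1 ≤ h / 4 := by omega
  have hn : 1 ≤ h / 4 := by omega
  have h4n : 2 * 2 * (h / 4) ≤ h := by omega
  have h4nL : 4 * (h / 4) ≤ L := by omega
  have hRr : R ≤ h / 4 - 1 := by omega
  have hL0 : (0 : ℝ) ≤ (L : ℝ) ^ 2 := by positivity
  calc _ ≤ _ := integral_slab_antitone (criticalProbI 3) L (a := 2 * 2 * (h / 4)) (by omega) h4n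
    _ ≤ 576 * (L : ℝ) ^ 2 *
          (bondPercolation (zdGraph 3) (criticalProbI 3)).real (armH (h / 4 - 1)) :=
        integral_slab_four_le (criticalProbI 3) hn h4nL
    _ ≤ 576 * (L : ℝ) ^ 2 * (ε / 576) := by
        gcongr
        exact (hR _ hRr).le
    _ = ε * (L : ℝ) ^ 2 := by ring

end Summit.CriticalPhenomena.PercolationContinuityZ3.Theorems.BudgetTightness

end
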